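import Summits.CriticalPhenomena.CardyFormulaZ2.Theorems.ParafermionPrecompact.Negative.TwoPassages
import Summits.CriticalPhenomena.CardyFormulaZ2.Theorems.CardyComplexConeSLESixFamiliesGiveCardySmoothMarkFamiliesPart1
import Literature.Probability.Percolation.ZdOneArmPowerBound
import Literature.Probability.Percolation.BondPercolationSymmetry
import HarnessLib

/-!
# `ParafermionPrecompact` (stmt-CriticalPhenomena-11293): the a-priori ONE-ARM bound on the
# `q = 1` parafermion in the bulk — clause (i) of the repaired crux `C′` at the RSW exponent

Prover `prover-line-stmt-CriticalPhenomena-11293-c4-0` (line lead c4, line `four-class-vertex-transfer`),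
helper file `--supports stmt-CriticalPhenomena-11293`, in the vocabulary of the `Negative/` files of the
crux (`F Λ δ z = ∫ passageSum (medialExploration (Λ δ) ω) δ (1/3) z dP_{1/2}`).

The crux as typed is `¬ParafermionBulkNondegenerate` (p74235) and awaits restatement; its repair
`C′ = ParafermionPrecompactRepairedAt` asks for `‖F_δ‖ ≤ C δ^{1/3}` and equicontinuity at scale `δ^{1/3}`
on compacts of `Ω`.  What the tree knew so far about `C′` is the FREE exponent `0` (`‖F_δ‖ ≤ 2`,
`Negative.norm_F_le_two`) and the exponent bookkeeping `Negative.clauses_of_bound_lt` (a bound at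
exponent `t` gives BOTH repaired clauses at every `s < t`).  This file proves the first GENUINE
percolation estimate on the crux observable — the "RSW gives some `s₀ > 0`" of the disprover's notes:

* §1 **Left vertices are wired to the arcs** (`exists_reachable_arcs`): along the orbit of the
  turning rule from a start corner, the primal (left) vertex of every corner is joined to a site of
  `zdArcA ∪ zdArcB` by a path of `ω`-OPEN lattice edges (induction: crossing a closed edge keeps the
  vertex; following an open edge `e` either lands on the arcs or `e` is not a wired arc-`A` edge, hence
  `e ∈ ω`).  Consequently (`exists_reachable_arcs_of_mem_medialExploration`) a passage of the
  exploration through `z` forces an `ω`-open path from an endpoint of `z` to the discrete boundary.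
* §2 **Geometry**: boundary-arc sites are within `2δ` of `Ωᶜ` (from
  `exists_frontier_near_of_mem_zdBoundary`), points of a compact `K ⊆ Ω` are at distance `≥ r_K > 0`
  from `Ωᶜ`, endpoints of a lattice edge are within `δ` of its medial point, and mesh points at
  Euclidean distance `> 2δR` differ by a lattice vector outside `box 2 R`.
* §3 **Probability**: `‖F Λ δ z‖ ≤ 2 P(E)` for any event `E` containing `{z ∈ γ}` (no measurability
  needed: `toMeasurable`), and the far-reach event "some `w` with `w - v ∉ box 2 R` is `ω`-reachable
  from `v`" has probability `≤ C (1/R)^α` — the tree's one-arm power bound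
  `exists_real_boxToFar_le_rpow_of_le_half` (Nolin 2008, Prop. 14) moved to `v` by translation
  invariance (`bondPercolation_real_preimage_shift`).
* §4 **The bound** (`exists_oneArm_bound`): there is a universal `α > 0` such that for every Dobrushin
  domain `D`, every family `Λ` with `(Λ δ).Ω = D.carrier`, `(Λ δ).δ = δ`, eventually admissible, and
  every compact `K ⊆ D.carrier`, eventually in `δ`, `‖F Λ δ z‖ ≤ C_K δ^α` for ALL medial vertices `z`
  with `medialPoint δ z ∈ K` (`C_K = 4 C (8/r_K)^α`); hence (`repairedClauses_of_lt_oneArm`) BOTH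
  repaired clauses of `C′` hold at every exponent `s < α`, for every such family — no arc-convergence
  hypothesis is used.  The gap to the crux is exactly `α ↦ 1/3` (conjecturally the one-arm exponent is
  `5/48`, the passage probability is the two-arm `δ^{1/4}`, and `1/4 → 1/3` is winding-phase cancellation).
-/

noncomputable section

namespace Summit.CriticalPhenomena.CardyFormulaZ2.Theorems.ParafermionPrecompact.OneArmBound

open _root_.Literature.Probability.LatticeModels _root_.Literature.Probability.RandomPlanarGeometry
open _root_.Literature.Probability.Percolation _root_.MeasureTheory _root_.Filter _root_.Set
open _root_.Literature.Probability.LatticeModels.DiscreteDobrushin (startCorner exitTime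
  isStartCorner_startCorner medialExploration_eq_explorationList isInnerFace_of_lt_exitTime)
open Summit.CriticalPhenomena.CardyFormulaZ2.Theorems.ParafermionPrecompact.Negative
open Summit.CriticalPhenomena.CardyFormulaZ2.Cruxes.SLESixFamiliesGiveCardy.CollarTouchSandwich
  (exists_frontier_near_of_mem_zdBoundary)
open scoped _root_.Topology

/-! ## §1 Left vertices of the exploration are joined to the arcs by `ω`-open paths -/

section Orbit

variable {Dd : DiscreteDobrushin} {ω : BondConfig (Site 2)} {c₀ : Site 2 × Fin 4}

/-- **Left vertices are wired to the arcs by open edges of `ω` itself.**  Along the orbit of the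
turning rule from a corner whose vertex lies on the arc `A`, the vertex of every corner is joined to
some site of `zdArcA ∪ zdArcB` by a path in the open graph of the RAW configuration `ω` (not only of
the completed `bcBondConfig ω`): crossing a closed edge keeps the vertex; following an open edge
`e = {v, u}` of the completed configuration either lands on the arcs (`u ∈ zdArcA ∪ zdArcB`, trivial
path) or `e` is not a wired arc-`A` edge (its endpoint `u` is off `A`), hence `e ∈ ω`.
(Smirnov 2001, §2: "open hexagons on the left are connected to the arc"; square-lattice bond version.)
[folklore] -/
theorem exists_reachable_arcs (hc₀ : c₀.1 ∈ Dd.zdArcA) (n : ℕ) :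
    ∃ w ∈ Dd.zdArcA ∪ Dd.zdArcB,
      (openGraph ω).Reachable (cornerOrbit (Dd.bcBondConfig ω) c₀ n).1 w := by
  induction n with
  | zero => exact ⟨c₀.1, Or.inl hc₀, SimpleGraph.Reachable.refl _⟩
  | succ n ih =>
    obtain ⟨w, hw, hreach⟩ := ih
    rw [cornerOrbit_succ]
    set p := cornerOrbit (Dd.bcBondConfig ω) c₀ n with hp
    by_cases h : cTgt p ∈ Dd.bcBondConfig ω
    · rw [nextCorner_of_mem h]
      by_cases hu : p.1 + cornerUnit (p.2 + 1) ∈ Dd.zdArcA ∪ Dd.zdArcB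
      · exact ⟨_, hu, SimpleGraph.Reachable.refl _⟩
      · have hω : s(p.1, p.1 + cornerUnit (p.2 + 1)) ∈ ω := by
          rcases h with ⟨-, hA | ⟨hω, -⟩⟩
          · exact absurd (Or.inl (hA _ (Sym2.mem_mk_right _ _))) hu
          · exact hω
        have hadj : (openGraph ω).Adj (p.1 + cornerUnit (p.2 + 1)) p.1 := by
          rw [openGraph_adj, Sym2.eq_swap]
          refine ⟨hω, fun heq => cornerUnit_ne_zero (p.2 + 1) ?_⟩
          simpa using heq
        exact ⟨w, hw, hadj.reachable.trans hreach⟩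
    · rw [nextCorner_of_not_mem h]
      exact ⟨w, hw, hreach⟩

/-- **A passage forces an open path to the boundary.**  For admissible data, if the medial vertex
`z` lies on the exploration path of `ω`, then some endpoint of `z` is joined to a site of the discrete
arcs `zdArcA ∪ zdArcB` by a path of `ω`-open edges. [folklore] -/
theorem exists_reachable_arcs_of_mem_medialExploration (hD : Dd.IsZdAdmissible) {z : MedialVertex}
    (hz : z ∈ medialExploration Dd ω) :
    ∃ v ∈ z, ∃ w ∈ Dd.zdArcA ∪ Dd.zdArcB, (openGraph ω).Reachable v w := by
  rw [medialExploration_eq_explorationList hD ω] at hz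
  obtain ⟨i, hi, rfl⟩ := List.getElem_of_mem hz
  rw [getElem_explorationList']
  obtain ⟨w, hw, hr⟩ :=
    exists_reachable_arcs (ω := ω) (isStartCorner_startCorner hD).mem_zdArcA i
  exact ⟨_, fst_mem_cSrc _, w, hw, hr⟩

end Orbit

/-! ## §2 Geometry: arcs are near `Ωᶜ`, `K` is far from `Ωᶜ`, endpoints are near medial points -/

section Geometry

/-- A site of the discrete arcs of data discretising the (open) carrier of a Dobrushin domain has a
point of the complement of the carrier within `2δ` of its mesh point. [folklore] -/
theorem exists_not_mem_near_of_mem_arcs {D : DobrushinDomain} {Dd : DiscreteDobrushin}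
    (hΩ : Dd.Ω = D.carrier) (hδ : 0 ≤ Dd.δ) {w : Site 2} (hw : w ∈ Dd.zdArcA ∪ Dd.zdArcB) :
    ∃ q ∉ D.carrier, dist (meshPoint Dd.δ w) q ≤ 2 * Dd.δ := by
  have hwb : w ∈ Dd.zdBoundary := by
    rcases hw with hw | hw
    · exact Dd.zdArcA_subset_zdBoundary hw
    · exact Dd.zdArcB_subset_zdBoundary hw
  have hopen : IsOpen Dd.Ω := hΩ ▸ D.isOpen
  obtain ⟨q, hq, hqd⟩ := exists_frontier_near_of_mem_zdBoundary hopen hδ hwb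
  refine ⟨q, ?_, hqd⟩
  rw [hopen.frontier_eq, hΩ] at hq
  exact hq.2

/-- A compact subset of an open set of `ℂ` keeps a positive distance from the complement. [folklore] -/
theorem exists_pos_le_dist_of_isCompact {K U : Set ℂ} (hK : IsCompact K) (hU : IsOpen U)
    (hKU : K ⊆ U) : ∃ r > 0, ∀ k ∈ K, ∀ q ∉ U, r ≤ dist k q := by
  obtain ⟨r, hr, hsub⟩ := hK.exists_thickening_subset_open hU hKU
  refine ⟨r, hr, fun k hk q hq => ?_⟩
  by_contra hlt
  push Not at hlt
  exact hq (hsub (Metric.mem_thickening_iff.2 ⟨k, hk, by rwa [dist_comm]⟩))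

/-- An endpoint of a nearest-neighbour edge of `δℤ²` is within `|δ|` of its medial point (in fact at
distance `|δ|/2`). [folklore] -/
theorem dist_meshPoint_medialPoint_le {δ : ℝ} {z : MedialVertex} (hz : z ∈ (zdGraph 2).edgeSet)
    {v : Site 2} (hv : v ∈ z) : dist (meshPoint δ v) (medialPoint δ z) ≤ |δ| := by
  induction z using Sym2.ind with
  | h x y =>
    have hxy : (zdGraph 2).Adj x y := (SimpleGraph.mem_edgeSet _).1 hz
    have hd : dist (meshPoint δ x) (meshPoint δ y) = |δ| := dist_meshPoint_of_adj hxy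
    have key : ∀ a b : ℂ, dist a ((a + b) / 2) = dist a b / 2 := fun a b => by
      rw [dist_eq_norm, dist_eq_norm, show a - (a + b) / 2 = (a - b) / 2 by ring, norm_div]
      norm_num
    rw [medialPoint_mk]
    rcases Sym2.mem_iff.1 hv with rfl | rfl
    · rw [key, hd]
      linarith [abs_nonneg δ]
    · rw [add_comm, key, dist_comm, hd]
      linarith [abs_nonneg δ]

/-- Mesh points whose lattice difference lies in `box 2 R` are within `2|δ|R` of each other. [folklore] -/
theorem dist_meshPoint_le_of_sub_mem_box {δ : ℝ} {v w : Site 2} {R : ℕ} (h : w - v ∈ box 2 R) :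
    dist (meshPoint δ v) (meshPoint δ w) ≤ 2 * |δ| * R := by
  rw [mem_box] at h
  have h0 := h 0
  have h1 := h 1
  simp only [Pi.sub_apply] at h0 h1
  rw [Complex.dist_eq]
  refine (Complex.norm_le_abs_re_add_abs_im _).trans ?_
  have hre : (meshPoint δ v - meshPoint δ w).re = δ * ((v 0 : ℝ) - w 0) := by
    simp only [Complex.sub_re, meshPoint_re]; ring
  have him : (meshPoint δ v - meshPoint δ w).im = δ * ((v 1 : ℝ) - w 1) := by
    simp only [Complex.sub_im, meshPoint_im]; ring
  rw [hre, him, abs_mul, abs_mul]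
  have e0 : |((v 0 : ℝ) - w 0)| ≤ R := by
    rw [abs_sub_comm, abs_le]
    constructor <;> push_cast [← Int.cast_sub] <;> exact_mod_cast (by omega : _)
  have e1 : |((v 1 : ℝ) - w 1)| ≤ R := by
    rw [abs_sub_comm, abs_le]
    constructor <;> push_cast [← Int.cast_sub] <;> exact_mod_cast (by omega : _)
  nlinarith [abs_nonneg δ]

end Geometry

/-! ## §3 Probability: `‖F‖ ≤ 2 P(E)` for any event containing the passages; the far-reach event -/

section Probability

/-- **`‖F Λ δ z‖ ≤ 2 P(E)`** for every event `E` that contains all configurations whose exploration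
passes through `z` (at most two unimodular passage terms, `Negative.norm_passageSum_medialExploration_le_two`).
No measurability of `E` is needed (the bound goes through its measurable hull). [folklore] -/
theorem norm_F_le_two_mul_real (Λ : ℝ → DiscreteDobrushin) {δ : ℝ} (hD : (Λ δ).IsZdAdmissible)
    (z : MedialVertex) {E : Set (BondConfig (Site 2))}
    (hE : ∀ ω, z ∈ medialExploration (Λ δ) ω → ω ∈ E) :
    ‖F Λ δ z‖ ≤ 2 * (bondPercolation (zdGraph 2) half).real E := by
  set μ := bondPercolation (zdGraph 2) half with hμ
  have hmeas : MeasurableSet (toMeasurable μ E) := measurableSet_toMeasurable μ E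
  unfold F
  calc ‖∫ ω, MedialPath.passageSum (medialExploration (Λ δ) ω) δ (1 / 3) z ∂μ‖
      ≤ ∫ ω, (toMeasurable μ E).indicator (fun _ => (2:ℝ)) ω ∂μ := by
        refine norm_integral_le_of_norm_le ((integrable_const (2:ℝ)).indicator hmeas)
          (Eventually.of_forall fun ω => ?_)
        by_cases hω : z ∈ medialExploration (Λ δ) ω
        · rw [Set.indicator_of_mem (subset_toMeasurable μ E (hE ω hω))]
          exact norm_passageSum_medialExploration_le_two hD ω δ _ z
        · rw [MedialPath.passageSum_eq_zero_of_not_mem _ _ hω, norm_zero]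
          exact Set.indicator_nonneg (fun _ _ => zero_le_two) _
    _ = 2 * μ.real E := by
        rw [integral_indicator_const _ hmeas, smul_eq_mul, mul_comm, measureReal_def,
          measure_toMeasurable, ← measureReal_def]

/-- **The far-reach event has one-arm probability.**  If the one-arm bound
`P(B(r) ↔ B(R)ᶜ) ≤ C (r/R)^α` holds at `p = 1/2` (as supplied by
`exists_real_boxToFar_le_rpow_of_le_half`), then for every site `v` and `R ≥ 1` the event "some site
`w` with `w - v ∉ box 2 R` is joined to `v` by an open path" has probability `≤ C (1/R)^α`
(translation invariance of `P_{1/2}`). [folklore] -/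
theorem real_farReach_le {C α : ℝ}
    (hCα : ∀ r R : ℕ, 1 ≤ r → r ≤ R →
      (bondPercolation (zdGraph 2) half).real
          {ω | ∃ x ∈ box 2 r, ∃ y ∉ box 2 R, ω ∈ openConnIn Set.univ x y} ≤ C * ((r : ℝ) / R) ^ α)
    (v : Site 2) {R : ℕ} (hR : 1 ≤ R) :
    (bondPercolation (zdGraph 2) half).real
        {ω | ∃ w : Site 2, w - v ∉ box 2 R ∧ (openGraph ω).Reachable v w} ≤ C * ((1 : ℝ) / R) ^ α := by
  have hsub : {ω : BondConfig (Site 2) | ∃ w : Site 2, w - v ∉ box 2 R ∧ (openGraph ω).Reachable v w} ⊆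
      BondConfig.relabel (sym2Equiv (Site.shift (-v))) ⁻¹'
        {ω | ∃ x ∈ box 2 1, ∃ y ∉ box 2 R, ω ∈ openConnIn Set.univ x y} := by
    rintro ω ⟨w, hw, hr⟩
    have h := relabel_mem_openConnIn (Site.shift (-v)) (openConnIn_univ_of_reachable hr)
    rw [Set.image_univ_of_surjective (Site.shift (-v)).surjective, Site.shift_apply,
      Site.shift_apply, add_neg_cancel, ← sub_eq_add_neg] at h
    refine ⟨0, by simp [mem_box], w - v, hw, h⟩
  calc (bondPercolation (zdGraph 2) half).real
        {ω | ∃ w : Site 2, w - v ∉ box 2 R ∧ (openGraph ω).Reachable v w}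
      ≤ (bondPercolation (zdGraph 2) half).real
          (BondConfig.relabel (sym2Equiv (Site.shift (-v))) ⁻¹'
            {ω | ∃ x ∈ box 2 1, ∃ y ∉ box 2 R, ω ∈ openConnIn Set.univ x y}) :=
        measureReal_mono hsub
    _ = (bondPercolation (zdGraph 2) half).real
          {ω | ∃ x ∈ box 2 1, ∃ y ∉ box 2 R, ω ∈ openConnIn Set.univ x y} :=
        bondPercolation_real_preimage_shift (-v) half _
    _ ≤ C * ((1 : ℝ) / R) ^ α := by
        have := hCα 1 R le_rfl hR
        simpa using this

end Probability

/-! ## §4 The a-priori bound: clause (i) of `C′` at the one-arm exponent, for every family -/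

section Bound

/-- Eventually `δ < c` along `δ → 0⁺`, for `c > 0`. [folklore] -/
theorem eventually_lt_nhdsWithin_Ioi {c : ℝ} (hc : 0 < c) : ∀ᶠ δ in 𝓝[>] (0:ℝ), δ < c := by
  filter_upwards [Ioo_mem_nhdsGT hc] with δ h using h.2

/-- **The one-arm a-priori bound for the `q = 1` parafermion (clause (i) of `C′` at the RSW
exponent).**  There is a universal `α > 0` such that for every Dobrushin domain `D`, every family `Λ`
of discrete Dobrushin data with `(Λ δ).Ω = D.carrier`, `(Λ δ).δ = δ`, admissible for all small `δ`,
and every compact `K ⊆ D.carrier`, there is `C` with, eventually as `δ → 0⁺`,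
`‖F Λ δ z‖ ≤ C δ^α` for ALL medial vertices `z` with `medialPoint δ z ∈ K` (genuine or not; off the
lattice edges `F ≡ 0`).  Proof: a passage through `z` forces an `ω`-open path from an endpoint of `z`
(within `δ` of `K`) to the discrete arcs (within `2δ` of `Ωᶜ`, at distance `≥ r_K` from `K`), i.e.
a one-arm crossing from scale `1` to scale `R = ⌊r_K/(4δ)⌋`, of probability `≤ C₁ R^{-α}` by the
tree's one-arm power bound (Nolin 2008, Prop. 14, via RSW) and translation invariance; two endpoints,
two passages: `‖F‖ ≤ 4 C₁ R^{-α} ≤ 4 C₁ (8/r_K)^α δ^α`. [folklore] -/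
theorem exists_oneArm_bound :
    ∃ α : ℝ, 0 < α ∧ ∀ (D : DobrushinDomain) (Λ : ℝ → DiscreteDobrushin),
      (∀ δ, (Λ δ).Ω = D.carrier) → (∀ δ, (Λ δ).δ = δ) →
      (∀ᶠ δ in 𝓝[>] (0:ℝ), (Λ δ).IsZdAdmissible) →
      ∀ K : Set ℂ, IsCompact K → K ⊆ D.carrier →
        ∃ C : ℝ, ∀ᶠ δ in 𝓝[>] (0:ℝ), ∀ z : MedialVertex, medialPoint δ z ∈ K →
          ‖F Λ δ z‖ ≤ C * δ ^ α := by
  obtain ⟨C₁, α, hC₁, hα, harm⟩ := exists_real_boxToFar_le_rpow_of_le_half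
  have harm' : ∀ r R : ℕ, 1 ≤ r → r ≤ R → (bondPercolation (zdGraph 2) half).real
      {ω | ∃ x ∈ box 2 r, ∃ y ∉ box 2 R, ω ∈ openConnIn Set.univ x y} ≤ C₁ * ((r : ℝ) / R) ^ α :=
    fun r R hr hrR => harm half (by rw [coe_half]) r R hr hrR
  refine ⟨α, hα, fun D Λ hΩ hδ hadm K hK hKD => ?_⟩
  obtain ⟨r, hr, hfar⟩ := exists_pos_le_dist_of_isCompact hK D.isOpen hKD
  refine ⟨4 * C₁ * (8 / r) ^ α, ?_⟩
  filter_upwards [hadm, eventually_lt_nhdsWithin_Ioi (show 0 < r / 8 by positivity),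
    self_mem_nhdsWithin] with δ hD hδr hδpos
  rw [Set.mem_Ioi] at hδpos
  intro z hzK
  -- the scale `R = ⌊r / (4δ)⌋ ≥ 1`, with `2δR ≤ r/2` and `1/R ≤ 8δ/r`
  set R : ℕ := ⌊r / (4 * δ)⌋₊ with hRdef
  have hRle : (R : ℝ) ≤ r / (4 * δ) := Nat.floor_le (by positivity)
  have hRgt : r / (4 * δ) < R + 1 := Nat.lt_floor_add_one _
  have h2 : 2 ≤ r / (4 * δ) := by
    rw [le_div_iff₀ (by positivity)]; linarith
  have hR1 : 1 ≤ R := by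
    have : (1 : ℝ) < R + 1 - 1 + 1 := by linarith
    exact_mod_cast (show (1 : ℝ) ≤ R by linarith)
  have hRpos : (0 : ℝ) < R := by exact_mod_cast hR1
  have h2δR : 2 * δ * R ≤ r / 2 := by
    have := mul_le_mul_of_nonneg_left hRle (show 0 ≤ 2 * δ by positivity)
    calc 2 * δ * R ≤ 2 * δ * (r / (4 * δ)) := this
      _ = r / 2 := by field_simp; ring
  have hinvR : (1 : ℝ) / R ≤ 8 / r * δ := by
    rw [div_le_iff₀ hRpos]
    have : r / (8 * δ) ≤ R := by
      have h' : r / (4 * δ) - 1 ≤ R := by linarith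
      have h'' : r / (8 * δ) ≤ r / (4 * δ) - 1 := by
        rw [div_le_iff₀ (by positivity)]
        have : r / (4 * δ) * (8 * δ) = 2 * r := by field_simp; ring
        nlinarith
      linarith
    calc (1:ℝ) = 8 / r * δ * (r / (8 * δ)) := by field_simp
      _ ≤ 8 / r * δ * R := mul_le_mul_of_nonneg_left this (by positivity)
  -- the event: far reach from one of the two endpoints of `z`
  have hΩδ : (Λ δ).Ω = D.carrier := hΩ δ
  have hδδ : (Λ δ).δ = δ := hδ δ
  induction z using Sym2.ind with
  | h a b =>
    set E : Set (BondConfig (Site 2)) :=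
      {ω | ∃ w : Site 2, w - a ∉ box 2 R ∧ (openGraph ω).Reachable a w} ∪
        {ω | ∃ w : Site 2, w - b ∉ box 2 R ∧ (openGraph ω).Reachable b w} with hEdef
    have hE : ∀ ω, s(a, b) ∈ medialExploration (Λ δ) ω → ω ∈ E := by
      intro ω hzγ
      have hedge : s(a, b) ∈ (zdGraph 2).edgeSet := mem_edgeSet_of_mem_medialExploration hzγ
      obtain ⟨v, hv, w, hw, hreach⟩ := exists_reachable_arcs_of_mem_medialExploration hD hzγ
      -- `w` is far from `v` in the lattice
      have hfarw : w - v ∉ box 2 R := by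
        intro hbox
        obtain ⟨q, hqΩ, hqw⟩ := exists_not_mem_near_of_mem_arcs hΩδ (by rw [hδδ]; exact hδpos.le) hw
        rw [hδδ] at hqw
        have h1 : r ≤ dist (medialPoint δ s(a, b)) q := hfar _ hzK q hqΩ
        have h2 : dist (meshPoint δ v) (medialPoint δ s(a, b)) ≤ δ := by
          have := dist_meshPoint_medialPoint_le (δ := δ) hedge hv
          rwa [abs_of_pos hδpos] at this
        have h3 : dist (meshPoint δ v) (meshPoint δ w) ≤ 2 * δ * R := by
          have := dist_meshPoint_le_of_sub_mem_box (δ := δ) hbox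
          rwa [abs_of_pos hδpos] at this
        have h4 : dist (medialPoint δ s(a, b)) q ≤ dist (medialPoint δ s(a, b)) (meshPoint δ v) +
            dist (meshPoint δ v) (meshPoint δ w) + dist (meshPoint δ w) q := dist_triangle4 _ _ _ _
        rw [dist_comm (medialPoint δ s(a, b)) (meshPoint δ v)] at h4
        linarith
      rcases Sym2.mem_iff.1 hv with rfl | rfl
      · exact Or.inl ⟨w, hfarw, hreach⟩
      · exact Or.inr ⟨w, hfarw, hreach⟩
    have hPa := real_farReach_le harm' a hR1
    have hPb := real_farReach_le harm' b hR1
    have hunion : (bondPercolation (zdGraph 2) half).real E ≤ 2 * (C₁ * ((1 : ℝ) / R) ^ α) := by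
      refine (measureReal_union_le _ _).trans ?_
      linarith
    have hpow : ((1 : ℝ) / R) ^ α ≤ (8 / r) ^ α * δ ^ α := by
      rw [← Real.mul_rpow (by positivity) hδpos.le]
      exact Real.rpow_le_rpow (by positivity) hinvR hα.le
    calc ‖F Λ δ s(a, b)‖ ≤ 2 * (bondPercolation (zdGraph 2) half).real E :=
          norm_F_le_two_mul_real Λ hD _ hE
      _ ≤ 2 * (2 * (C₁ * ((1 : ℝ) / R) ^ α)) := by linarith
      _ = 4 * C₁ * ((1 : ℝ) / R) ^ α := by ring
      _ ≤ 4 * C₁ * ((8 / r) ^ α * δ ^ α) :=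
          mul_le_mul_of_nonneg_left hpow (by positivity)
      _ = 4 * C₁ * (8 / r) ^ α * δ ^ α := by ring

/-- **`C′` below the one-arm exponent.**  With `α > 0` as above: for every `s < α`, every Dobrushin
domain, every such family and every compact `K ⊆ Ω`, BOTH repaired clauses of
`ParafermionPrecompactRepairedAt` hold with `δ^s` in place of `δ^{1/3}` — the bound clause and the
equicontinuity clause on genuine medial vertices (`Negative.clauses_of_bound_lt`).  The repaired crux
is the same statement at `s = 1/3`. [folklore] -/
theorem repairedClauses_of_lt_oneArm :
    ∃ α : ℝ, 0 < α ∧ ∀ s : ℝ, s < α → ∀ (D : DobrushinDomain) (Λ : ℝ → DiscreteDobrushin),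
      (∀ δ, (Λ δ).Ω = D.carrier) → (∀ δ, (Λ δ).δ = δ) →
      (∀ᶠ δ in 𝓝[>] (0:ℝ), (Λ δ).IsZdAdmissible) →
      ∀ K : Set ℂ, IsCompact K → K ⊆ D.carrier →
        (∃ C : ℝ, ∀ᶠ δ in 𝓝[>] (0:ℝ), ∀ z : MedialVertex, z ∈ (zdGraph 2).edgeSet →
          medialPoint δ z ∈ K → ‖F Λ δ z‖ ≤ C * δ ^ s) ∧
        (∀ ε > (0:ℝ), ∃ η > (0:ℝ), ∀ᶠ δ in 𝓝[>] (0:ℝ), ∀ z z' : MedialVertex,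
          z ∈ (zdGraph 2).edgeSet → z' ∈ (zdGraph 2).edgeSet →
          medialPoint δ z ∈ K → medialPoint δ z' ∈ K →
          dist (medialPoint δ z) (medialPoint δ z') < η →
            ‖F Λ δ z - F Λ δ z'‖ ≤ ε * δ ^ s) := by
  obtain ⟨α, hα, h⟩ := exists_oneArm_bound
  refine ⟨α, hα, fun s hs D Λ hΩ hδ hadm K hK hKD => ?_⟩
  obtain ⟨C, hC⟩ := h D Λ hΩ hδ hadm K hK hKD
  exact clauses_of_bound_lt hs ⟨C, hC.mono fun δ hδ' z _ hzK => hδ' z hzK⟩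

/-- The same for a family satisfying the six crux hypotheses (`Negative.IsFamily`), in the exact shape
of `Negative.ParafermionPrecompactRepairedAt` with exponent `s < α` in place of `1/3`. [folklore] -/
theorem repairedClauses_of_lt_oneArm_of_isFamily :
    ∃ α : ℝ, 0 < α ∧ ∀ s : ℝ, s < α → ∀ (D : DobrushinDomain) (Λ : ℝ → DiscreteDobrushin),
      IsFamily D Λ → ∀ K : Set ℂ, IsCompact K → K ⊆ D.carrier →
        (∃ C : ℝ, ∀ᶠ δ in 𝓝[>] (0:ℝ), ∀ z : MedialVertex, z ∈ (zdGraph 2).edgeSet →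
          medialPoint δ z ∈ K → ‖F Λ δ z‖ ≤ C * δ ^ s) ∧
        (∀ ε > (0:ℝ), ∃ η > (0:ℝ), ∀ᶠ δ in 𝓝[>] (0:ℝ), ∀ z z' : MedialVertex,
          z ∈ (zdGraph 2).edgeSet → z' ∈ (zdGraph 2).edgeSet →
          medialPoint δ z ∈ K → medialPoint δ z' ∈ K →
          dist (medialPoint δ z) (medialPoint δ z') < η →
            ‖F Λ δ z - F Λ δ z'‖ ≤ ε * δ ^ s) := by
  obtain ⟨α, hα, h⟩ := repairedClauses_of_lt_oneArm
  exact ⟨α, hα, fun s hs D Λ hΛ K hK hKD => h s hs D Λ hΛ.1 hΛ.2.1 hΛ.2.2.2.2.2 K hK hKD⟩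

end Bound

end Summit.CriticalPhenomena.CardyFormulaZ2.Theorems.ParafermionPrecompact.OneArmBound

end
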